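import Summits.HodgeConjecture.HodgeConjecture.Theorems.K2LiuSlotOnePermutationFrame
import Summits.HodgeConjecture.HodgeConjecture.Theorems.K2LiuLineThetaKernelCharTwist
import HarnessLib

/-!
# SLOT 2 of #44∕45R: from the slot frame `dD ∘ natAdd = −(dD ∘ castAdd)` at `⟨a′⟩, λ̃⁻¹` to the letter frame `d_V` at `⟨−a′⟩, λ̃`, up to an automorphic
# character — organ (O44h) of socket #44∕45R (assembly Step 4, `K2/K2Liu-p03/g3/ROAD-44-45R-Assembly`)

Track B ∕ hLiu418 = stmt-HodgeConjecture-24832, line `K2_Liu_CurveThetaSigs`, unit U6 ED. 6, socket #44∕45R `sig_K2LiuUndoublingSeparation`;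
seat `hodgecm-mathlib-K2Liu-p03` (g3).  After undoubling (★ `K2LiuDoubledKernelAtIota.lineThetaKer_dD_iotaV`) slot 2 is the line-theta kernel at the
frame `F₂ = dD ∘ natAdd = −F₁`, `F₁ = dD ∘ castAdd` (`F₁ k = d_V (x k)·1`), line `⟨a′⟩`, character `λ̃⁻¹`, at `k₂(g) = reindex e₁ (g ⊗ 1)`.  The chain
`(−F₁, ⟨a′⟩) ≡ (F₁, ⟨(−1)·a′⟩)` (★ `lineThetaKer_rescale`, `c = −1`) → `(d_V, ⟨(−1)·a′⟩)` (★ `lineThetaKer_frameTransport` along the permutation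
isometry of ★ `K2LiuSlotOnePermutationFrame`) → `⟨−a′⟩` (★ `lineThetaKer_line_congr`, `(−1)·a′ = −a′`) → `λ̃⁻¹ ↦ λ̃` (★
`K2LiuLineThetaKernelCharTwist.exists_twist_lineThetaKer_split`) gives:

* `dD_natAdd_eq_neg_one_smul_castAdd` — `dD ∘ natAdd = (−1) • (dD ∘ castAdd)` as frames;
* `adelicIsometryConj_permMatrix_of_coe` — `Ad(B⁻¹ ⊗ 1) k = g` for ANY `k ∈ U(diag F₁)(𝔸)` with the matrix of `k₁(g)` (retypings change no matrix);
* **`exists_slotTwo_eq_twist`** — `∃ R` linear and continuous characters `η₁` of `U(diag d_V)(𝔸)`, `η₂` of `U(⟨−a′⟩)(𝔸)`, trivial on the rational points,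
  with `θ^{dD∘natAdd,⟨a′⟩,λ⁻¹}_{Φ}(mk k₂(g)⁻¹, mk u) = η₁(g) · η₂(u₂⁻¹) · θ^{d_V,⟨−a′⟩,λ}_{RΦ}(mk g⁻¹, mk u₂)` for all `Φ, g, u`, `u₂` with the matrix of `u` —
  slot 2 of the display, the `x₂`-character `η₁` being (E6)'s `W₂`-factor and `η₂` the `q`-weight factor ([HarrisKudlaSweet1996, (1.30)]'s `χ(det g₂)`).

No definition, no instance, no named fact, no `sorry`; axioms ⊆ {propext, Classical.choice, Quot.sound}.

## References
* [Liu2021] Y. Liu, Camb. J. Math. 9 (2021), Def. 4.11; App. D §D.1 Step 1 (footnote l. 5215), Step 2.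
* [HarrisKudlaSweet1996] M. Harris, S. Kudla, W. J. Sweet, J. AMS 9 (1996), §1 Lem. 1.1 p. 953, (1.30).
* [GelbartRogawski1991] S. Gelbart, J. Rogawski, Invent. Math. 105 (1991), §3.1 Remark p. 457.
* [Kudla1994] S. Kudla, Israel J. Math. 87 (1994), §3 Thm. 3.1.

HONEST LABEL: HC_CM is proved only modulo the 7 printed citations (2 remaining named inputs: hLiu418 = stmt-HodgeConjecture-24832, h413 =
stmt-HodgeConjecture-24833) until rung 0 closes; this helper moves no counter.
-/

set_option autoImplicit false

set_option linter.dupNamespace false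

noncomputable section

open scoped Classical
open scoped Matrix Kronecker ComplexConjugate
open NumberField IsDedekindDomain
open Literature.RepresentationTheory.HeisenbergGroup
open Literature.NumberTheory.Automorphic
open Literature.NumberTheory.Weil1964
open Literature.NumberTheory.GaloisRepresentations
open Literature.RepresentationTheory.HarrisKudlaSweet1996

namespace Summit.HodgeConjecture.HodgeConjecture.Cruxes.HLiu418.K2LiuSlotTwoPermutationFrame

open Literature.NumberTheory.Automorphic.UnitaryGroup
open Literature.NumberTheory.Automorphic.IdeleClassGroup
open Literature.NumberTheory.GelbartRogawski1991 Literature.NumberTheory.GelbartRogawski1991.UnitaryDualPair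
open Literature.NumberTheory.GelbartRogawski1991.GRConstruction
open Literature.NumberTheory.Automorphic.Liu2021 Literature.NumberTheory.Automorphic.Liu2021.Def411WeilCarriers
open Literature.NumberTheory.Automorphic.Liu2021.Def411WeilCarriersDoubling
open Literature.NumberTheory.K2Lit.DoubledLineTheta
open Literature.RepresentationTheory.Liu2021
open Summit.HodgeConjecture.HodgeConjecture.Cruxes.HLiu418.K2LiuConjugateSymplecticInv (IsConjugateSymplectic.inv)
open Summit.HodgeConjecture.HodgeConjecture.Cruxes.HLiu418.K2LiuLineThetaKernelFrameTransport
open Summit.HodgeConjecture.HodgeConjecture.Cruxes.HLiu418.K2LiuLineThetaKernelCharTwist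
open Summit.HodgeConjecture.HodgeConjecture.Cruxes.HLiu418.K2LiuSlotOnePermutationFrame

variable (L : Type) [Field L] [NumberField L] [IsCMField L] (e₁ : Fin 2 × Fin 1 ≃ Fin 2)
  (dV : Fin 2 → L) (hdV : ∀ i, IsCMField.complexConj L (dV i) = dV i) (hdV0 : ∀ i, dV i ≠ 0)

/-! ## §1 The second slot frame is `(−1) •` the first; the conjugation lemma for retyped block elements -/

/-- **`dD ∘ natAdd = (−1) • (dD ∘ castAdd)`** (as frame functions `Fin 2 → L`): `dD (natAdd k) = −t₀ k`, `dD (castAdd k) = t₀ k`.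
[cite: HarrisKudlaSweet1996, §1 (1.9)] -/
theorem dD_natAdd_eq_neg_one_smul_castAdd :
    (fun i => dD L e₁ dV hdV (fun _ : Fin 1 => (1 : L)) (fun _ => map_one _) (Fin.natAdd 2 i)) =
      fun i => (((-1 : (Fp L)ˣ) : Fp L) : L) * dD L e₁ dV hdV (fun _ : Fin 1 => (1 : L)) (fun _ => map_one _) (Fin.castAdd 2 i) := by
  funext i
  simp only [dD, finSumFinEquiv_symm_apply_castAdd, finSumFinEquiv_symm_apply_natAdd, Sum.elim_inl, Sum.elim_inr, Pi.neg_apply,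
    NegMemClass.coe_neg, Units.val_neg, Units.val_one, OneMemClass.coe_one, neg_mul, one_mul]

/-- **`Ad(B⁻¹ ⊗ 1) k = g`** for ANY `k ∈ U(diag(dD ∘ castAdd))(𝔸)` whose matrix is that of `k₁(g) = reindex e₁ (g ⊗ 1)` (retypings along equal subgroups
change no matrix; ★ `adelicIsometryConj_permMatrix_reindexGL`). [cite: Liu2021, §B.3 p. 101] -/
theorem adelicIsometryConj_permMatrix_of_coe (B : GL (Fin 2) L)
    (hBval : (B : Matrix (Fin 2) (Fin 2) L) = Equiv.Perm.permMatrix L (e₁.symm.trans (Equiv.prodUnique (Fin 2) (Fin 1))))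
    (g : UnitaryGroup.adelic (Fp L) L (IsCMField.complexConj L) 2 (Matrix.diagonal dV))
    (k : UnitaryGroup.adelic (Fp L) L (IsCMField.complexConj L) 2
      (Matrix.diagonal fun i => dD L e₁ dV hdV (fun _ : Fin 1 => (1 : L)) (fun _ => map_one _) (Fin.castAdd 2 i)))
    (hk : (k : GL (Fin 2) (AdeleRing (𝓞 L) L)) = UnitaryGroup.reindexGL e₁
        ((UnitaryGroup.adelicInl (Fp L) L (IsCMField.complexConj L) 2 1 (Matrix.diagonal dV) (Matrix.diagonal fun _ : Fin 1 => (1 : L)) g :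
          UnitaryGroup.adelicPair (Fp L) L (IsCMField.complexConj L) 2 1 (Matrix.diagonal dV) (Matrix.diagonal fun _ : Fin 1 => (1 : L))) :
            GL (Fin 2 × Fin 1) (AdeleRing (𝓞 L) L))) :
    adelicIsometryConj (Fp L) L (IsCMField.complexConj L) 2 (aOfB L B)
        (aOfB_isometry L dV (fun i => dD L e₁ dV hdV (fun _ : Fin 1 => (1 : L)) (fun _ => map_one _) (Fin.castAdd 2 i)) B
          (formCongr_permMatrix_diagonal_castAdd L e₁ dV hdV B hBval)) k = g := by
  have hk' : k = ⟨_, reindexGL_adelicInl_mem_castAdd' L e₁ dV hdV g⟩ := Subtype.ext hk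
  rw [hk']
  exact adelicIsometryConj_permMatrix_reindexGL L e₁ dV hdV B hBval g _
where
  /-- the membership of ★ `K2LiuDoubledKernelAtIota.reindexGL_adelicInl_mem_castAdd` at `N = 2`, `dW = 1` (restated to keep this file's imports light). -/
  reindexGL_adelicInl_mem_castAdd' (L : Type) [Field L] [NumberField L] [IsCMField L] (e₁ : Fin 2 × Fin 1 ≃ Fin 2) (dV : Fin 2 → L)
      (hdV : ∀ i, IsCMField.complexConj L (dV i) = dV i) (g : UnitaryGroup.adelic (Fp L) L (IsCMField.complexConj L) 2 (Matrix.diagonal dV)) :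
      UnitaryGroup.reindexGL e₁
        ((UnitaryGroup.adelicInl (Fp L) L (IsCMField.complexConj L) 2 1 (Matrix.diagonal dV) (Matrix.diagonal fun _ : Fin 1 => (1 : L)) g :
          UnitaryGroup.adelicPair (Fp L) L (IsCMField.complexConj L) 2 1 (Matrix.diagonal dV) (Matrix.diagonal fun _ : Fin 1 => (1 : L))) :
            GL (Fin 2 × Fin 1) (AdeleRing (𝓞 L) L)) ∈
      UnitaryGroup.adelic (Fp L) L (IsCMField.complexConj L) 2
        (Matrix.diagonal fun i => dD L e₁ dV hdV (fun _ : Fin 1 => (1 : L)) (fun _ => map_one _) (Fin.castAdd 2 i)) := by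
    have h := (UnitaryGroup.reindexGL_mem_iff (UnitaryGroup.conjAdele (Fp L) L (IsCMField.complexConj L)) e₁
      (UnitaryGroup.adelicForm L 2 (Matrix.diagonal dV) ⊗ₖ UnitaryGroup.adelicForm L 1 (Matrix.diagonal fun _ : Fin 1 => (1 : L))) _).2
      (UnitaryGroup.adelicInl (Fp L) L (IsCMField.complexConj L) 2 1 (Matrix.diagonal dV) (Matrix.diagonal fun _ : Fin 1 => (1 : L)) g).2
    have hform : Matrix.reindex e₁ e₁ (UnitaryGroup.adelicForm L 2 (Matrix.diagonal dV) ⊗ₖ UnitaryGroup.adelicForm L 1 (Matrix.diagonal fun _ : Fin 1 => (1 : L))) =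
        UnitaryGroup.adelicForm L 2 (Matrix.diagonal fun i => dD L e₁ dV hdV (fun _ : Fin 1 => (1 : L)) (fun _ => map_one _) (Fin.castAdd 2 i)) := by
      unfold UnitaryGroup.adelicForm
      rw [Matrix.diagonal_map (map_zero _), Matrix.diagonal_map (map_zero _), Matrix.diagonal_kronecker_diagonal, Matrix.reindex_apply,
        Matrix.submatrix_diagonal_equiv, Matrix.diagonal_map (map_zero _)]
      refine congrArg Matrix.diagonal (funext fun k => ?_)
      simp only [Function.comp_apply, dD, finSumFinEquiv_symm_apply_castAdd, Sum.elim_inl, coe_cmGramEntry, map_mul]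
    rw [hform] at h
    exact h

/-! ## §2 Slot 2 -/

/-- **SLOT 2.**  For `e₁ : Fin 2 × Fin 1 ≃ Fin 2`, `B ∈ GL₂(L)` with matrix `permMatrix (e₁⁻¹ ≫ fst)`, a conjugate-symplectic `λ` and a line `a′` (Weil majorants at
the six intermediate data are the caller's): there are a ℂ-linear `R` on `𝒮(𝔸^2)` and CONTINUOUS characters `η₁ : U(diag d_V)(𝔸) →* ℂˣ`,
`η₂ : U(⟨−a′⟩)(𝔸) →* ℂˣ`, trivial on the rational points, such that for all `Φ`, `g`, `u ∈ U(⟨a′⟩)(𝔸)`, `u₂ ∈ U(⟨−a′⟩)(𝔸)` with the matrix of `u`,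
`θ^{dD∘natAdd,⟨a′⟩,λ⁻¹}_Φ(mk k₂(g)⁻¹, mk u) = η₁(g) · η₂(u₂⁻¹) · θ^{d_V,⟨−a′⟩,λ}_{RΦ}(mk g⁻¹, mk u₂)` — slot 2 of the display of #44∕45R.
[cite: Liu2021, App. D §D.1 Steps 1–2 (l. 5215–5219)] [cite: HarrisKudlaSweet1996, §1 Lem. 1.1 p. 953, (1.30)] [cite: GelbartRogawski1991, §3.1 Remark p. 457 L4–13]
[cite: Kudla1994, §3 Thm. 3.1] -/
theorem exists_slotTwo_eq_twist (lam : Literature.NumberTheory.Automorphic.IdeleClassGroup L →ₜ* Circle) (hlam : IsConjugateSymplectic L lam)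
    (a' : (Fp L)ˣ) (B : GL (Fin 2) L)
    (hBval : (B : Matrix (Fin 2) (Fin 2) L) = Equiv.Perm.permMatrix L (e₁.symm.trans (Equiv.prodUnique (Fin 2) (Fin 1))))
    (hρF₂ : HasThetaMajorants fun
      (p : ↥(UnitaryGroup.adelic (Fp L) L (IsCMField.complexConj L) 2 (Matrix.diagonal (fun i => dD L e₁ dV hdV (fun _ : Fin 1 => (1 : L)) (fun _ => map_one _) (Fin.natAdd 2 i)))) ×
        ↥(UnitaryGroup.adelic (Fp L) L (IsCMField.complexConj L) 1 (JW (Fp L) L a')))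
      (Φ : piSchwartzBruhat (Fp L) (Fin 2)) =>
        pairRep (Fp L) L (IsCMField.complexConj L) 2 1 e₁ (Matrix.diagonal (fun i => dD L e₁ dV hdV (fun _ : Fin 1 => (1 : L)) (fun _ => map_one _) (Fin.natAdd 2 i))) (JW (Fp L) L a')
          (chiSplittingLine L e₁ (fun i => dD L e₁ dV hdV (fun _ : Fin 1 => (1 : L)) (fun _ => map_one _) (Fin.natAdd 2 i)) (fun i => dD_conj L e₁ dV hdV (fun _ : Fin 1 => (1 : L)) (fun _ => map_one _) (Fin.natAdd 2 i)) (fun i => dD_ne_zero L e₁ dV hdV (fun _ : Fin 1 => (1 : L)) (fun _ => map_one _) hdV0 (fun _ => one_ne_zero) (Fin.natAdd 2 i))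
            (toHeckeCharacter L lam⁻¹) (isUnitary_toHeckeCharacter L lam⁻¹)
            ((isOscillatorChar_toHeckeCharacter_iff lam⁻¹).mpr (IsConjugateSymplectic.inv hlam)) (TW (Fp L) a')
            (isUnit_det_TW (Fp L) a') (JW (Fp L) L a') (JW_eq (Fp L) L a'))
          p Φ)
    (hρcF₁ : HasThetaMajorants fun
      (p : ↥(UnitaryGroup.adelic (Fp L) L (IsCMField.complexConj L) 2 (Matrix.diagonal (fun i => (((-1 : (Fp L)ˣ) : Fp L) : L) * (fun i => dD L e₁ dV hdV (fun _ : Fin 1 => (1 : L)) (fun _ => map_one _) (Fin.castAdd 2 i)) i))) ×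
        ↥(UnitaryGroup.adelic (Fp L) L (IsCMField.complexConj L) 1 (JW (Fp L) L a')))
      (Φ : piSchwartzBruhat (Fp L) (Fin 2)) =>
        pairRep (Fp L) L (IsCMField.complexConj L) 2 1 e₁ (Matrix.diagonal (fun i => (((-1 : (Fp L)ˣ) : Fp L) : L) * (fun i => dD L e₁ dV hdV (fun _ : Fin 1 => (1 : L)) (fun _ => map_one _) (Fin.castAdd 2 i)) i)) (JW (Fp L) L a')
          (chiSplittingLine L e₁ (fun i => (((-1 : (Fp L)ˣ) : Fp L) : L) * (fun i => dD L e₁ dV hdV (fun _ : Fin 1 => (1 : L)) (fun _ => map_one _) (Fin.castAdd 2 i)) i) (complexConj_smul_frame L (fun i => dD L e₁ dV hdV (fun _ : Fin 1 => (1 : L)) (fun _ => map_one _) (Fin.castAdd 2 i)) (-1) (fun i => dD_conj L e₁ dV hdV (fun _ : Fin 1 => (1 : L)) (fun _ => map_one _) (Fin.castAdd 2 i))) (smul_frame_ne_zero L (fun i => dD L e₁ dV hdV (fun _ : Fin 1 => (1 : L)) (fun _ => map_one _) (Fin.castAdd 2 i)) (-1) (fun i => dD_ne_zero L e₁ dV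 hdV (fun _ : Fin 1 => (1 : L)) (fun _ => map_one _) hdV0 (fun _ => one_ne_zero) (Fin.castAdd 2 i)))
            (toHeckeCharacter L lam⁻¹) (isUnitary_toHeckeCharacter L lam⁻¹)
            ((isOscillatorChar_toHeckeCharacter_iff lam⁻¹).mpr (IsConjugateSymplectic.inv hlam)) (TW (Fp L) a')
            (isUnit_det_TW (Fp L) a') (JW (Fp L) L a') (JW_eq (Fp L) L a'))
          p Φ)
    (hρF₁c : HasThetaMajorants fun
      (p : ↥(UnitaryGroup.adelic (Fp L) L (IsCMField.complexConj L) 2 (Matrix.diagonal (fun i => dD L e₁ dV hdV (fun _ : Fin 1 => (1 : L)) (fun _ => map_one _) (Fin.castAdd 2 i)))) ×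
        ↥(UnitaryGroup.adelic (Fp L) L (IsCMField.complexConj L) 1 (JW (Fp L) L ((-1 : (Fp L)ˣ) * a'))))
      (Φ : piSchwartzBruhat (Fp L) (Fin 2)) =>
        pairRep (Fp L) L (IsCMField.complexConj L) 2 1 e₁ (Matrix.diagonal (fun i => dD L e₁ dV hdV (fun _ : Fin 1 => (1 : L)) (fun _ => map_one _) (Fin.castAdd 2 i))) (JW (Fp L) L ((-1 : (Fp L)ˣ) * a'))
          (chiSplittingLine L e₁ (fun i => dD L e₁ dV hdV (fun _ : Fin 1 => (1 : L)) (fun _ => map_one _) (Fin.castAdd 2 i)) (fun i => dD_conj L e₁ dV hdV (fun _ : Fin 1 => (1 : L)) (fun _ => map_one _) (Fin.castAdd 2 i)) (fun i => dD_ne_zero L e₁ dV hdV (fun _ : Fin 1 => (1 : L)) (fun _ => map_one _) hdV0 (fun _ => one_ne_zero) (Fin.castAdd 2 i))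
            (toHeckeCharacter L lam⁻¹) (isUnitary_toHeckeCharacter L lam⁻¹)
            ((isOscillatorChar_toHeckeCharacter_iff lam⁻¹).mpr (IsConjugateSymplectic.inv hlam)) (TW (Fp L) ((-1 : (Fp L)ˣ) * a'))
            (isUnit_det_TW (Fp L) ((-1 : (Fp L)ˣ) * a')) (JW (Fp L) L ((-1 : (Fp L)ˣ) * a')) (JW_eq (Fp L) L ((-1 : (Fp L)ˣ) * a')))
          p Φ)
    (hρVc : HasThetaMajorants fun
      (p : ↥(UnitaryGroup.adelic (Fp L) L (IsCMField.complexConj L) 2 (Matrix.diagonal dV)) ×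
        ↥(UnitaryGroup.adelic (Fp L) L (IsCMField.complexConj L) 1 (JW (Fp L) L ((-1 : (Fp L)ˣ) * a'))))
      (Φ : piSchwartzBruhat (Fp L) (Fin 2)) =>
        pairRep (Fp L) L (IsCMField.complexConj L) 2 1 e₁ (Matrix.diagonal dV) (JW (Fp L) L ((-1 : (Fp L)ˣ) * a'))
          (chiSplittingLine L e₁ dV hdV hdV0
            (toHeckeCharacter L lam⁻¹) (isUnitary_toHeckeCharacter L lam⁻¹)
            ((isOscillatorChar_toHeckeCharacter_iff lam⁻¹).mpr (IsConjugateSymplectic.inv hlam)) (TW (Fp L) ((-1 : (Fp L)ˣ) * a'))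
            (isUnit_det_TW (Fp L) ((-1 : (Fp L)ˣ) * a')) (JW (Fp L) L ((-1 : (Fp L)ˣ) * a')) (JW_eq (Fp L) L ((-1 : (Fp L)ˣ) * a')))
          p Φ)
    (hρVn' : HasThetaMajorants fun
      (p : ↥(UnitaryGroup.adelic (Fp L) L (IsCMField.complexConj L) 2 (Matrix.diagonal dV)) ×
        ↥(UnitaryGroup.adelic (Fp L) L (IsCMField.complexConj L) 1 (JW (Fp L) L (-a'))))
      (Φ : piSchwartzBruhat (Fp L) (Fin 2)) =>
        pairRep (Fp L) L (IsCMField.complexConj L) 2 1 e₁ (Matrix.diagonal dV) (JW (Fp L) L (-a'))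
          (chiSplittingLine L e₁ dV hdV hdV0
            (toHeckeCharacter L lam⁻¹) (isUnitary_toHeckeCharacter L lam⁻¹)
            ((isOscillatorChar_toHeckeCharacter_iff lam⁻¹).mpr (IsConjugateSymplectic.inv hlam)) (TW (Fp L) (-a'))
            (isUnit_det_TW (Fp L) (-a')) (JW (Fp L) L (-a')) (JW_eq (Fp L) L (-a')))
          p Φ)
    (hρVn : HasThetaMajorants fun
      (p : ↥(UnitaryGroup.adelic (Fp L) L (IsCMField.complexConj L) 2 (Matrix.diagonal dV)) ×
        ↥(UnitaryGroup.adelic (Fp L) L (IsCMField.complexConj L) 1 (JW (Fp L) L (-a'))))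
      (Φ : piSchwartzBruhat (Fp L) (Fin 2)) =>
        pairRep (Fp L) L (IsCMField.complexConj L) 2 1 e₁ (Matrix.diagonal dV) (JW (Fp L) L (-a'))
          (chiSplittingLine L e₁ dV hdV hdV0
            (toHeckeCharacter L lam) (isUnitary_toHeckeCharacter L lam)
            ((isOscillatorChar_toHeckeCharacter_iff lam).mpr hlam) (TW (Fp L) (-a'))
            (isUnit_det_TW (Fp L) (-a')) (JW (Fp L) L (-a')) (JW_eq (Fp L) L (-a')))
          p Φ) :
    ∃ (R : piSchwartzBruhat (Fp L) (Fin 2) →ₗ[ℂ] piSchwartzBruhat (Fp L) (Fin 2))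
      (η₁ : UnitaryGroup.adelic (Fp L) L (IsCMField.complexConj L) 2 (Matrix.diagonal dV) →* ℂˣ)
      (η₂ : UnitaryGroup.adelic (Fp L) L (IsCMField.complexConj L) 1 (JW (Fp L) L (-a')) →* ℂˣ),
      Continuous η₁ ∧ Continuous η₂ ∧
      (∀ γ ∈ (UnitaryGroup.toAdelic (Fp L) L (IsCMField.complexConj L) 2 (Matrix.diagonal dV)).range, η₁ γ = 1) ∧
      (∀ γ ∈ (UnitaryGroup.toAdelic (Fp L) L (IsCMField.complexConj L) 1 (JW (Fp L) L (-a'))).range, η₂ γ = 1) ∧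
      ∀ (Φ : piSchwartzBruhat (Fp L) (Fin 2)) (g : UnitaryGroup.adelic (Fp L) L (IsCMField.complexConj L) 2 (Matrix.diagonal dV))
        (u : UnitaryGroup.adelic (Fp L) L (IsCMField.complexConj L) 1 (JW (Fp L) L a'))
        (u₂ : UnitaryGroup.adelic (Fp L) L (IsCMField.complexConj L) 1 (JW (Fp L) L (-a')))
        (_hu : (u₂ : GL (Fin 1) (AdeleRing (𝓞 L) L)) = (u : GL (Fin 1) (AdeleRing (𝓞 L) L)))
        (hk : UnitaryGroup.reindexGL e₁
          ((UnitaryGroup.adelicInl (Fp L) L (IsCMField.complexConj L) 2 1 (Matrix.diagonal dV) (Matrix.diagonal fun _ : Fin 1 => (1 : L)) g :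
            UnitaryGroup.adelicPair (Fp L) L (IsCMField.complexConj L) 2 1 (Matrix.diagonal dV) (Matrix.diagonal fun _ : Fin 1 => (1 : L))) :
              GL (Fin 2 × Fin 1) (AdeleRing (𝓞 L) L)) ∈
          UnitaryGroup.adelic (Fp L) L (IsCMField.complexConj L) 2 (Matrix.diagonal (fun i => dD L e₁ dV hdV (fun _ : Fin 1 => (1 : L)) (fun _ => map_one _) (Fin.natAdd 2 i)))),
        (lineThetaKernelDatum L 2 e₁ (fun i => dD L e₁ dV hdV (fun _ : Fin 1 => (1 : L)) (fun _ => map_one _) (Fin.natAdd 2 i)) (fun i => dD_conj L e₁ dV hdV (fun _ : Fin 1 => (1 : L)) (fun _ => map_one _) (Fin.natAdd 2 i)) (fun i => dD_ne_zero L e₁ dV hdV (fun _ : Fin 1 => (1 : L)) (fun _ => map_one _) hdV0 (fun _ => one_ne_zero) (Fin.natAdd 2 i)) lam⁻¹ (IsConjugateSymplectic.inv hlam) a' hρF₂).thetaKer Φ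
            (QuotientGroup.mk (⟨_, hk⟩ : UnitaryGroup.adelic (Fp L) L (IsCMField.complexConj L) 2 (Matrix.diagonal (fun i => dD L e₁ dV hdV (fun _ : Fin 1 => (1 : L)) (fun _ => map_one _) (Fin.natAdd 2 i))))⁻¹, QuotientGroup.mk u) =
          ((η₁ g : ℂˣ) : ℂ) * ((η₂ u₂⁻¹ : ℂˣ) : ℂ) *
            (lineThetaKernelDatum L 2 e₁ dV hdV hdV0 lam hlam (-a') hρVn).thetaKer (R Φ) (QuotientGroup.mk g⁻¹, QuotientGroup.mk u₂) := by
  -- (iii) the frame transport along the permutation isometry, at the line `(−1)·a′`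
  obtain ⟨R, hR⟩ := lineThetaKer_frameTransport L 2 e₁ (fun i => dD L e₁ dV hdV (fun _ : Fin 1 => (1 : L)) (fun _ => map_one _) (Fin.castAdd 2 i)) (fun i => dD_conj L e₁ dV hdV (fun _ : Fin 1 => (1 : L)) (fun _ => map_one _) (Fin.castAdd 2 i)) (fun i => dD_ne_zero L e₁ dV hdV (fun _ : Fin 1 => (1 : L)) (fun _ => map_one _) hdV0 (fun _ => one_ne_zero) (Fin.castAdd 2 i)) dV hdV hdV0 lam⁻¹ (IsConjugateSymplectic.inv hlam) ((-1 : (Fp L)ˣ) * a') B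
    (formCongr_permMatrix_diagonal_castAdd L e₁ dV hdV B hBval) hρF₁c hρVc
  -- (v) the character twist `λ̃⁻¹ ↦ λ̃` at `(d_V, ⟨−a′⟩)`
  obtain ⟨η₁, η₂, hη₁c, hη₂c, hη₁rat, hη₂rat, hη⟩ := exists_twist_lineThetaKer_split L 2 e₁ dV hdV hdV0 (-a') lam hlam lam⁻¹
    (IsConjugateSymplectic.inv hlam) hρVn hρVn'
  refine ⟨R, η₁, η₂, hη₁c, hη₂c, hη₁rat, hη₂rat, fun Φ g u u₂ hu hk => ?_⟩
  -- the retyped elements along the chain: same matrices throughout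
  have hF := dD_natAdd_eq_neg_one_smul_castAdd L e₁ dV hdV
  have ha : (-1 : (Fp L)ˣ) * a' = -a' := neg_one_mul a'
  -- (i) equal frames `F₂ = (−1) • F₁`
  have h1 := lineThetaKer_frame_congr L 2 e₁ lam⁻¹ (IsConjugateSymplectic.inv hlam) a' hF (fun i => dD_conj L e₁ dV hdV (fun _ : Fin 1 => (1 : L)) (fun _ => map_one _) (Fin.natAdd 2 i)) (fun i => dD_ne_zero L e₁ dV hdV (fun _ : Fin 1 => (1 : L)) (fun _ => map_one _) hdV0 (fun _ => one_ne_zero) (Fin.natAdd 2 i)) (complexConj_smul_frame L (fun i => dD L e₁ dV hdV (fun _ : Fin 1 => (1 : L)) (fun _ => map_one _) (Fin.castAdd 2 i)) (-1) (fun i => dD_conj L e₁ dV hdV (fun _ : Fin 1 => (1 : L)) (fun _ => map_one _) (Fin.castAdd 2 i))) (smul_frame_ne_zero L (fun i => dD L e₁ dV hdV (fun _ : Fin 1 => (1 : L)) (fun _ => map_one _) (Fin.castAdd 2 i)) (-1) (fun i => dD_ne_zero L e₁ dV hdV (fun _ : Fin 1 => (1 : L)) (fun _ => map_one _) hdV0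 (fun _ => one_ne_zero) (Fin.castAdd 2 i))) hρF₂ hρcF₁ Φ
    ((⟨_, hk⟩ : UnitaryGroup.adelic (Fp L) L (IsCMField.complexConj L) 2 (Matrix.diagonal (fun i => dD L e₁ dV hdV (fun _ : Fin 1 => (1 : L)) (fun _ => map_one _) (Fin.natAdd 2 i))))⁻¹) u
  -- (ii) the W-rescaling `((−1)•F₁, ⟨a′⟩) ≡ (F₁, ⟨(−1)·a′⟩)`
  have h2 := lineThetaKer_rescale L 2 e₁ (fun i => dD L e₁ dV hdV (fun _ : Fin 1 => (1 : L)) (fun _ => map_one _) (Fin.castAdd 2 i)) (fun i => dD_conj L e₁ dV hdV (fun _ : Fin 1 => (1 : L)) (fun _ => map_one _) (Fin.castAdd 2 i)) (fun i => dD_ne_zero L e₁ dV hdV (fun _ : Fin 1 => (1 : L)) (fun _ => map_one _) hdV0 (fun _ => one_ne_zero) (Fin.castAdd 2 i)) lam⁻¹ (IsConjugateSymplectic.inv hlam) a' (-1) hρcF₁ hρF₁c Φ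
    ((MulEquiv.subgroupCongr (congrArg (fun d => UnitaryGroup.adelic (Fp L) L (IsCMField.complexConj L) 2 (Matrix.diagonal d)) hF))
      ((⟨_, hk⟩ : UnitaryGroup.adelic (Fp L) L (IsCMField.complexConj L) 2 (Matrix.diagonal (fun i => dD L e₁ dV hdV (fun _ : Fin 1 => (1 : L)) (fun _ => map_one _) (Fin.natAdd 2 i))))⁻¹)) u
  -- (iii) the frame transport at the retyped block element, whose matrix is that of `k₁(g⁻¹)`
  have hkval : (((MulEquiv.subgroupCongr (adelic_diagonal_smul_frame L (fun i => dD L e₁ dV hdV (fun _ : Fin 1 => (1 : L)) (fun _ => map_one _) (Fin.castAdd 2 i)) (-1)))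
      ((MulEquiv.subgroupCongr (congrArg (fun d => UnitaryGroup.adelic (Fp L) L (IsCMField.complexConj L) 2 (Matrix.diagonal d)) hF))
        ((⟨_, hk⟩ : UnitaryGroup.adelic (Fp L) L (IsCMField.complexConj L) 2 (Matrix.diagonal (fun i => dD L e₁ dV hdV (fun _ : Fin 1 => (1 : L)) (fun _ => map_one _) (Fin.natAdd 2 i))))⁻¹)) :
        UnitaryGroup.adelic (Fp L) L (IsCMField.complexConj L) 2 (Matrix.diagonal (fun i => dD L e₁ dV hdV (fun _ : Fin 1 => (1 : L)) (fun _ => map_one _) (Fin.castAdd 2 i)))) : GL (Fin 2) (AdeleRing (𝓞 L) L)) =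
      UnitaryGroup.reindexGL e₁
        ((UnitaryGroup.adelicInl (Fp L) L (IsCMField.complexConj L) 2 1 (Matrix.diagonal dV) (Matrix.diagonal fun _ : Fin 1 => (1 : L)) g⁻¹ :
          UnitaryGroup.adelicPair (Fp L) L (IsCMField.complexConj L) 2 1 (Matrix.diagonal dV) (Matrix.diagonal fun _ : Fin 1 => (1 : L))) :
            GL (Fin 2 × Fin 1) (AdeleRing (𝓞 L) L)) := by
    rw [MulEquiv.subgroupCongr_apply, MulEquiv.subgroupCongr_apply, Subgroup.coe_inv, map_inv, Subgroup.coe_inv, map_inv]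
  have hAd := adelicIsometryConj_permMatrix_of_coe L e₁ dV hdV B hBval g⁻¹ _ hkval
  have h3 := (hR Φ _ ((MulEquiv.subgroupCongr (adelic_JW_mul L (-1) a').symm) u)).trans
    (congrArg (fun z => (lineThetaKernelDatum L 2 e₁ dV hdV hdV0 lam⁻¹ (IsConjugateSymplectic.inv hlam) ((-1 : (Fp L)ˣ) * a') hρVc).thetaKer (R Φ)
      (QuotientGroup.mk z, QuotientGroup.mk ((MulEquiv.subgroupCongr (adelic_JW_mul L (-1) a').symm) u))) hAd)
  -- (iv) the line `(−1)·a′ = −a′`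
  have h4 := lineThetaKer_line_congr L 2 e₁ dV hdV hdV0 lam⁻¹ (IsConjugateSymplectic.inv hlam) ha hρVc hρVn' (R Φ) g⁻¹
    ((MulEquiv.subgroupCongr (adelic_JW_mul L (-1) a').symm) u)
  -- the final `u₂`: same matrix as `u`
  have hu₂ : (MulEquiv.subgroupCongr (congrArg (fun b => UnitaryGroup.adelic (Fp L) L (IsCMField.complexConj L) 1 (JW (Fp L) L b)) ha))
      ((MulEquiv.subgroupCongr (adelic_JW_mul L (-1) a').symm) u) = u₂ :=
    Subtype.ext (by rw [MulEquiv.subgroupCongr_apply, MulEquiv.subgroupCongr_apply, hu])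
  -- (v) the character twist at `x := g⁻¹`, `q := u₂`
  have h5 := hη (R Φ) g⁻¹ u₂
  rw [inv_inv] at h5
  rw [hu₂] at h4
  exact h1.trans (h2.trans (h3.trans (h4.trans h5)))

end Summit.HodgeConjecture.HodgeConjecture.Cruxes.HLiu418.K2LiuSlotTwoPermutationFrame

end
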